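import Summits.CriticalPhenomena.Ising3DConformalLimit.Theorems.EnergyNotSigmaSquaredEnergyGapPowerLawLocalisation
import Literature.Probability.Percolation.TriAnnulusCrossingProofs

/-!
# Telescoping over dyadic scales: a per-scale conditional merging floor on a positive density of
# scales gives the finite-volume heart of `EnergyGapPowerLaw`
(item stmt-CriticalPhenomena-4469, route `EnergyNotSigmaSquared`, sub-problem `Ising3DConformalLimit`;
helper file `--supports stmt-CriticalPhenomena-4469`, line `registered` of the crux)

Notation: `β_c = criticalBeta 3`, `e₂ = Pi.single 1 1`,
`P_L = sourcedDoubleCurrentLaw 3 L β_c ({0}∆{x}) ({e₂}∆{x+e₂})` (finite-volume law, free box `Λ_L`, of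
the trace `n̂₁ ∪ n̂₂` of two independent sourced currents `0 → x`, `e₂ → x + e₂`),
`Conn_N = openConnVia (withinGraph ⊤ ↑(box 3 N)) 0 e₂ = {0 ↔ e₂ by open bonds inside Λ_N}`,
`a_k = 1 − P_L[Conn_{2^k}]` — the probability that the two clusters have NOT joined `0` to `e₂` inside the
dyadic box `Λ_{2^k}` (antitone in `k`).

The registered open stub of the skeleton after `…Localisation.lean` is the finite-volume heart
`∃ κ > 0, C, ∀ x ≠ 0, ∃ N, ∀ᶠ L, 1 − P_L[Conn_N] ≤ C‖x‖^{-κ}`.  The route's intended proof of it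
("harvest `B(β_c) = ∞` scale by scale: a per-scale conditional merging floor on a positive density of
dyadic scales ⟹ the stub by telescoping", Theses file and `Lines/birth.md`) has a mechanism-free half,
proved here:

* `antitone_seq_le_pow_card_filter` — the abstract telescoping: an antitone sequence `a` with `a 0 ≤ 1`
  that contracts by a factor `θ ∈ [0,1]` at every "good" step satisfies `a n ≤ θ^{#good steps below n}`;
* (reused) `Literature.Probability.Percolation.rpow_logb_two_comm` — `u^{log₂ v} = v^{log₂ u}`
  (turns `θ^{δ log₂‖x‖}` into `‖x‖^{-κ}`);
* **`localParAvoidancePowerLaw_of_scaleMergingFloor`** — if for some `q, δ > 0`, `R`, every `x` with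
  `‖x‖ ≥ R` admits, for all large `L`, a set `K` of dyadic scales with `#K ≥ δ log₂‖x‖`,
  `2^{k+1} ≤ ‖x‖` and the CONDITIONAL MERGING FLOOR `a_{k+1} ≤ (1 − q)·a_k` for `k ∈ K` (i.e.
  `P_L[Conn_{2^{k+1}} | ¬Conn_{2^k}] ≥ q`), then the finite-volume heart holds with
  `N = 2^{⌊log₂‖x‖⌋}`, `κ = δ·log₂(1/(1 − q ∧ ½))`;
* `stub_telescoping` — the registered glue stub of the skeleton, by name.

So after this file the crux's skeleton has ONE open stub, `stub_scaleMergingFloor`: the per-scale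
conditional merging floor for two INDEPENDENT critical sourced currents with ADJACENT sources, in finite
volume, on a positive density of the dyadic scales below `‖x‖` — the genuinely `d = 3` statement (false
for `d ≥ 5`, where the conditional merging probability per octave tends to `0`).

## References

* M. Aizenman, H. Duminil-Copin, Ann. of Math. 194 (2021), §4–§5 (multiscale intersection argument
  for sourced currents, `d = 4`) [AizenmanDuminilCopinAnnals2021].
* M. Aizenman, H. Duminil-Copin, V. Sidoravicius, Comm. Math. Phys. 334 (2015), Thm. 3.1
  [AizenmanDuminilCopinSidoraviciusCMP2015].
-/

noncomputable section

namespace Summit.CriticalPhenomena.Ising3DConformalLimit.EnergyNotSigmaSquaredEnergyGapPowerLaw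

open scoped symmDiff
open MeasureTheory Filter Topology
open Literature.Probability.LatticeModels Literature.Probability.Percolation
open Summit.CriticalPhenomena.Ising3DConformalLimit.Theorems.PerfectScreening (one_le_norm_of_ne_zero)

/-! ### Abstract telescoping -/

/-- **Telescoping over good steps.**  If `a : ℕ → ℝ` is antitone step by step, `a 0 ≤ 1`, and at every
good step `m` it contracts, `a (m+1) ≤ θ · a m` with `0 ≤ θ`, then
`a n ≤ θ ^ #{m < n | good m}` for every `n`. [folklore] -/
theorem antitone_seq_le_pow_card_filter {a : ℕ → ℝ} {θ : ℝ} (hθ : 0 ≤ θ) (ha0 : a 0 ≤ 1)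
    (hmono : ∀ m, a (m + 1) ≤ a m) (good : ℕ → Prop) [DecidablePred good]
    (hgood : ∀ m, good m → a (m + 1) ≤ θ * a m) (n : ℕ) :
    a n ≤ θ ^ ((Finset.range n).filter good).card := by
  induction n with
  | zero => simpa using ha0
  | succ n ih =>
    rw [Finset.range_add_one, Finset.filter_insert]
    have hn : n ∉ (Finset.range n).filter good := by simp
    by_cases hg : good n
    · rw [if_pos hg, Finset.card_insert_of_notMem hn, pow_succ]
      calc a (n + 1) ≤ θ * a n := hgood n hg
        _ ≤ θ * θ ^ ((Finset.range n).filter good).card := mul_le_mul_of_nonneg_left ih hθ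
        _ = θ ^ ((Finset.range n).filter good).card * θ := by ring
    · rw [if_neg hg]
      exact (hmono n).trans ih

/-! ### The finite-volume laws are probability measures for large boxes -/

/-- For `L` large (the four sources inside `Λ_L`), `P_L` is a probability measure (`β_c(3) > 0`, even
source sets). [cite: AizenmanDuminilCopinAnnals2021, §3.1] -/
theorem eventually_isProbabilityMeasure_sourcedDoubleCurrentLaw_par (x : Site 3) :
    ∀ᶠ L : ℕ in atTop, IsProbabilityMeasure (sourcedDoubleCurrentLaw 3 L (criticalBeta 3) ({0} ∆ {x})
      ({(Pi.single 1 1 : Site 3)} ∆ {x + Pi.single 1 1})) := by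
  have hβ : 0 < criticalBeta 3 := criticalBeta_pos_holds (d := 3) (by norm_num)
  obtain ⟨L₀, hL₀⟩ := exists_forall_subset_box 3
    (({0} ∆ {x}) ∪ ({(Pi.single 1 1 : Site 3)} ∆ {x + Pi.single 1 1}))
  refine eventually_atTop.2 ⟨L₀, fun L hL => ?_⟩
  have hsub := hL₀ L hL
  exact isProbabilityMeasure_sourcedDoubleCurrentLaw hβ.le
    (currentSum_boxSources_pos 3 hβ (Finset.union_subset_left hsub)
      (even_card_singleton_symmDiff _ _)).ne'
    (currentSum_boxSources_pos 3 hβ (Finset.union_subset_right hsub)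
      (even_card_singleton_symmDiff _ _)).ne'

/-! ### The telescoping glue -/

/-- **A per-scale conditional merging floor on a positive density of dyadic scales gives the
finite-volume heart.**  Hypothesis: there are `q, δ > 0` and `R` such that every `x` with `‖x‖ ≥ R`
admits, for all large `L`, a finite set `K` of scales with `#K ≥ δ log₂‖x‖`, each `k ∈ K` having
`2^{k+1} ≤ ‖x‖` and `1 − P_L[Conn_{2^{k+1}}] ≤ (1 − q)(1 − P_L[Conn_{2^k}])` (conditionally on not having
joined `0` to `e₂` inside `Λ_{2^k}`, the two clusters do so inside `Λ_{2^{k+1}}` with probability `≥ q`).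
Conclusion: the registered stub `stub_localParAvoidancePowerLaw` — with `N = 2^{⌊log₂‖x‖⌋}` and
`κ = δ log₂(1/(1 − q ∧ ½))`.  Proof: `a_k = 1 − P_L[Conn_{2^k}]` is antitone (`Conn` grows with the box),
`a_0 ≤ 1`, contracts by `1 − q ∧ ½` on `K ⊆ range ⌊log₂‖x‖⌋`, so `a_N ≤ (1−q∧½)^{#K} ≤ (1−q∧½)^{δ log₂‖x‖}
= ‖x‖^{-κ}`; `‖x‖ < R` is absorbed in the constant. [cite: AizenmanDuminilCopinAnnals2021, §4–§5] -/
theorem localParAvoidancePowerLaw_of_scaleMergingFloor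
    (h : ∃ q δ R : ℝ, 0 < q ∧ 0 < δ ∧ ∀ x : Site 3, R ≤ ‖x‖ → ∀ᶠ L : ℕ in atTop,
      ∃ K : Finset ℕ, δ * Real.logb 2 ‖x‖ ≤ (K.card : ℝ) ∧ ∀ k ∈ K, (2 : ℝ) ^ (k + 1) ≤ ‖x‖ ∧
        1 - (sourcedDoubleCurrentLaw 3 L (criticalBeta 3) ({0} ∆ {x})
              ({(Pi.single 1 1 : Site 3)} ∆ {x + Pi.single 1 1})).real
            (openConnVia (withinGraph ⊤ (↑(box 3 (2 ^ (k + 1))) : Set (Site 3))) 0 (Pi.single 1 1)) ≤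
          (1 - q) * (1 - (sourcedDoubleCurrentLaw 3 L (criticalBeta 3) ({0} ∆ {x})
              ({(Pi.single 1 1 : Site 3)} ∆ {x + Pi.single 1 1})).real
            (openConnVia (withinGraph ⊤ (↑(box 3 (2 ^ k)) : Set (Site 3))) 0 (Pi.single 1 1)))) :
    ∃ κ C : ℝ, 0 < κ ∧ ∀ x : Site 3, x ≠ 0 → ∃ N : ℕ, ∀ᶠ L : ℕ in atTop,
      1 - (sourcedDoubleCurrentLaw 3 L (criticalBeta 3) ({0} ∆ {x})
            ({(Pi.single 1 1 : Site 3)} ∆ {x + Pi.single 1 1})).real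
          (openConnVia (withinGraph ⊤ (↑(box 3 N) : Set (Site 3))) 0 (Pi.single 1 1)) ≤
        C * (‖x‖ : ℝ) ^ (-κ) := by
  obtain ⟨q, δ, R, hq, hδ, h⟩ := h
  -- the contraction factor `θ = 1 - q ∧ ½ ∈ [½, 1)`
  set q₀ : ℝ := min q (1 / 2) with hq₀
  have hq₀pos : 0 < q₀ := lt_min hq (by norm_num)
  have hq₀le : q₀ ≤ 1 / 2 := min_le_right _ _
  have hq₀leq : q₀ ≤ q := min_le_left _ _
  set θ : ℝ := 1 - q₀ with hθ
  have hθpos : 0 < θ := by rw [hθ]; linarith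
  have hθlt : θ < 1 := by rw [hθ]; linarith
  have hθnn : 0 ≤ θ := hθpos.le
  -- the exponent `κ = -δ log₂ θ > 0`
  have hlogθ : Real.logb 2 θ < 0 := Real.logb_neg one_lt_two hθpos hθlt
  set κ : ℝ := -(δ * Real.logb 2 θ) with hκ
  have hκpos : 0 < κ := by
    rw [hκ]; nlinarith
  -- the constant absorbs `‖x‖ < R`
  set R₁ : ℝ := max R 1 with hR₁
  have hR₁pos : 0 < R₁ := lt_of_lt_of_le one_pos (le_max_right _ _)
  refine ⟨κ, R₁ ^ κ, hκpos, fun x hx => ?_⟩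
  have hx1 : 1 ≤ ‖x‖ := one_le_norm_of_ne_zero hx
  have hxpos : 0 < ‖x‖ := lt_of_lt_of_le one_pos hx1
  have hρpos : 0 < (‖x‖ : ℝ) ^ (-κ) := Real.rpow_pos_of_pos hxpos _
  have hC1 : 1 ≤ R₁ ^ κ := Real.one_le_rpow (le_max_right _ _) hκpos.le
  by_cases hxR : R ≤ ‖x‖
  · -- the telescoping case
    set n : ℕ := ⌊Real.logb 2 ‖x‖⌋₊ with hn
    refine ⟨2 ^ n, ?_⟩
    have hlogx : 0 ≤ Real.logb 2 ‖x‖ := Real.logb_nonneg one_lt_two hx1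
    filter_upwards [h x hxR, eventually_isProbabilityMeasure_sourcedDoubleCurrentLaw_par x] with L hL hP
    obtain ⟨K, hKcard, hK⟩ := hL
    haveI := hP
    -- the antitone sequence `a k = 1 - P_L[Conn_{2^k}]`
    set μ := sourcedDoubleCurrentLaw 3 L (criticalBeta 3) ({0} ∆ {x})
      ({(Pi.single 1 1 : Site 3)} ∆ {x + Pi.single 1 1}) with hμ
    set a : ℕ → ℝ := fun k =>
      1 - μ.real (openConnVia (withinGraph ⊤ (↑(box 3 (2 ^ k)) : Set (Site 3))) 0 (Pi.single 1 1))
      with ha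
    have ha_nonneg : ∀ k, 0 ≤ a k := fun k => by
      simp only [ha]; linarith [measureReal_le_one (μ := μ)
        (s := openConnVia (withinGraph ⊤ (↑(box 3 (2 ^ k)) : Set (Site 3))) 0 (Pi.single 1 1))]
    have ha0 : a 0 ≤ 1 := by
      simp only [ha]; linarith [measureReal_nonneg (μ := μ)
        (s := openConnVia (withinGraph ⊤ (↑(box 3 (2 ^ 0)) : Set (Site 3))) 0 (Pi.single 1 1))]
    have hmono : ∀ m, a (m + 1) ≤ a m := by
      intro m
      simp only [ha]
      have hsub : openConnVia (withinGraph ⊤ (↑(box 3 (2 ^ m)) : Set (Site 3))) 0 (Pi.single 1 1) ⊆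
          openConnVia (withinGraph ⊤ (↑(box 3 (2 ^ (m + 1))) : Set (Site 3))) 0 (Pi.single 1 1) :=
        monotone_openConnVia_withinGraph_box (0 : Site 3) (Pi.single 1 1)
          (Nat.pow_le_pow_right (by norm_num) (Nat.le_succ m))
      linarith [measureReal_mono (μ := μ) hsub]
    have hgood : ∀ m, m ∈ K → a (m + 1) ≤ θ * a m := by
      intro m hm
      have h1 := (hK m hm).2
      have h2 : (1 - q) * a m ≤ θ * a m :=
        mul_le_mul_of_nonneg_right (by rw [hθ]; linarith) (ha_nonneg m)
      exact h1.trans h2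
    have htel := antitone_seq_le_pow_card_filter hθnn ha0 hmono (· ∈ K) hgood n
    -- `K ⊆ range n`, so the number of good steps below `n` is `#K`
    have hKsub : K ⊆ Finset.range n := by
      intro k hk
      rw [Finset.mem_range]
      have h2k := (hK k hk).1
      have hk1 : ((k + 1 : ℕ) : ℝ) ≤ Real.logb 2 ‖x‖ := by
        rw [Real.le_logb_iff_rpow_le one_lt_two hxpos, Real.rpow_natCast]
        exact h2k
      have : k + 1 ≤ n := by
        rw [hn, Nat.le_floor_iff hlogx]
        exact hk1
      omega
    have hfilter : (Finset.range n).filter (· ∈ K) = K := by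
      rw [Finset.filter_mem_eq_inter, Finset.inter_eq_right.2 hKsub]
    rw [hfilter] at htel
    -- `θ^{#K} ≤ θ^{δ log₂ ‖x‖} = ‖x‖^{-κ}`
    have hpow : θ ^ K.card ≤ θ ^ (δ * Real.logb 2 ‖x‖) := by
      rw [← Real.rpow_natCast]
      exact Real.rpow_le_rpow_of_exponent_ge hθpos hθlt.le hKcard
    have hident : θ ^ (δ * Real.logb 2 ‖x‖) = (‖x‖ : ℝ) ^ (-κ) := by
      -- `θ^{δ log₂‖x‖} = (θ^δ)^{log₂‖x‖} = ‖x‖^{log₂(θ^δ)} = ‖x‖^{δ log₂ θ}`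
      rw [hκ, neg_neg, Real.rpow_mul hθnn, rpow_logb_two_comm (Real.rpow_pos_of_pos hθpos δ) hxpos,
        Real.logb_rpow_eq_mul_logb_of_pos hθpos]
    calc a n ≤ θ ^ K.card := htel
      _ ≤ θ ^ (δ * Real.logb 2 ‖x‖) := hpow
      _ = (‖x‖ : ℝ) ^ (-κ) := hident
      _ = 1 * (‖x‖ : ℝ) ^ (-κ) := (one_mul _).symm
      _ ≤ R₁ ^ κ * (‖x‖ : ℝ) ^ (-κ) := mul_le_mul_of_nonneg_right hC1 hρpos.le
  · -- `‖x‖ < R`: the constant absorbs it (`1 ≤ R₁^κ ‖x‖^{-κ}`)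
    push Not at hxR
    refine ⟨1, Eventually.of_forall fun L => ?_⟩
    have hxR₁ : ‖x‖ ≤ R₁ := hxR.le.trans (le_max_left _ _)
    have hone : 1 ≤ R₁ ^ κ * (‖x‖ : ℝ) ^ (-κ) := by
      rw [Real.rpow_neg hxpos.le, ← div_eq_mul_inv, one_le_div (Real.rpow_pos_of_pos hxpos _)]
      exact Real.rpow_le_rpow hxpos.le hxR₁ hκpos.le
    have hle1 : 1 - (sourcedDoubleCurrentLaw 3 L (criticalBeta 3) ({0} ∆ {x})
        ({(Pi.single 1 1 : Site 3)} ∆ {x + Pi.single 1 1})).real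
          (openConnVia (withinGraph ⊤ (↑(box 3 1) : Set (Site 3))) 0 (Pi.single 1 1)) ≤ 1 :=
      sub_le_self _ measureReal_nonneg
    exact hle1.trans hone

/-- **Registered stub `stub_telescoping` of the crux skeleton (line `registered`,
`Cruxes/EnergyGapPowerLaw/Lines/birth.lean`)**: the per-scale conditional merging floor implies the
finite-volume heart — `localParAvoidancePowerLaw_of_scaleMergingFloor` by name.
[cite: AizenmanDuminilCopinAnnals2021, §4–§5] -/
theorem stub_telescoping :
    (∃ q δ R : ℝ, 0 < q ∧ 0 < δ ∧ ∀ x : Site 3, R ≤ ‖x‖ → ∀ᶠ L : ℕ in atTop,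
      ∃ K : Finset ℕ, δ * Real.logb 2 ‖x‖ ≤ (K.card : ℝ) ∧ ∀ k ∈ K, (2 : ℝ) ^ (k + 1) ≤ ‖x‖ ∧
        1 - (sourcedDoubleCurrentLaw 3 L (criticalBeta 3) ({0} ∆ {x})
              ({(Pi.single 1 1 : Site 3)} ∆ {x + Pi.single 1 1})).real
            (openConnVia (withinGraph ⊤ (↑(box 3 (2 ^ (k + 1))) : Set (Site 3))) 0 (Pi.single 1 1)) ≤
          (1 - q) * (1 - (sourcedDoubleCurrentLaw 3 L (criticalBeta 3) ({0} ∆ {x})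
              ({(Pi.single 1 1 : Site 3)} ∆ {x + Pi.single 1 1})).real
            (openConnVia (withinGraph ⊤ (↑(box 3 (2 ^ k)) : Set (Site 3))) 0 (Pi.single 1 1)))) →
    ∃ κ C : ℝ, 0 < κ ∧ ∀ x : Site 3, x ≠ 0 → ∃ N : ℕ, ∀ᶠ L : ℕ in atTop,
      1 - (sourcedDoubleCurrentLaw 3 L (criticalBeta 3) ({0} ∆ {x})
            ({(Pi.single 1 1 : Site 3)} ∆ {x + Pi.single 1 1})).real
          (openConnVia (withinGraph ⊤ (↑(box 3 N) : Set (Site 3))) 0 (Pi.single 1 1)) ≤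
        C * (‖x‖ : ℝ) ^ (-κ) :=
  localParAvoidancePowerLaw_of_scaleMergingFloor

end Summit.CriticalPhenomena.Ising3DConformalLimit.EnergyNotSigmaSquaredEnergyGapPowerLaw

end
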